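import Summits.CriticalPhenomena.PercolationContinuityZ3.Theorems.Transplant.SkelNegBParamsFaceFloorsClrXA
import Summits.CriticalPhenomena.PercolationContinuityZ3.Theorems.Transplant.SkelPhiFaceClearFloorsY
import HarnessLib

/-!
# N1 params, M3 group G-clr (y′-face) — **THE TANGENTIAL SEED CLEARANCE OF A y′-FACE AT THE (ζ′) TUPLE**: the field `hclr₃` of `Skelφ.FloorsY2`
# (SkelPhiFaceNumsYP2 :98–:101; per region of the tangential x-run the α-floor over the along range OR the level floor) — here by the LEVEL
# floor for EVERY region: the y′-face's along y′-run climbs `(Nr+1)` level strides `U·sLo ≥ n_Lℓ_L − 2U + 2` from the landing origin, so the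
# tangential x-run starts at level `|n_L·yT 1 − h_L·yT 0| ≥ (Nr+1)·(n_Lℓ_L − 2U + 2) − |Λ₁(yL)| − n_L`, while region `k` needs only
# `U·M_u + U·(xBoxB k + 1) ≤ 11·n_L·RA′·(k+2) + 4·n_Lℓ_L + 3U` (p1-g14, 2026-08-22; lead g8 07:03:26Z 'p1 lineage = G-clr, both faces').
Generic in the landing origin `yL` (reading `|F1cA yL| ≤ 8u₁`), the along count `Nr ≥ 13`, the tangential count `N₃ + 2 ≤ 2000·Kq`, the tangential sign
`σT` and start half-width `qB₃` (both idle in the level branch): **`hclr₃_YA_gen`**; the pinned `hclr₃_YA` is `hclr₃_YA_gen` at the y′-face skeleton's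
choice functions when p3 posts it.  The along fields `hclrLo/hclrHi` of `FloorsY2` are SERVED (`Skelφ.hclrP_of_clearF`/`hclrM_of_clearF`, p1-g13
p314730 ∘ `KS.clearF_s/d/t` p314880); **`hclrLo_YA_gen`/`hclrHi_YA_gen`** restate them in the field's shape from ONE origin floor each.
* `clr_lvl_crossOffY_bounds` — `σ(Nr+1)·U·sLo − n_L < n_L·(crossOffY …) 1 − h_L·(crossOffY …) 0 ≤ σ(Nr+1)·U·sLo`;
* `clr_abs_lvl_yTY_ge` — `(Nr+1)·(U·sLo) − 9m − n_L ≤ |n_L·yT 1 − h_L·yT 0|` for `yT = yL + crossOffY …`, `|F1cA yL| ≤ 8u₁`;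
* `clr_tanX_level_arith` — the pure-ℤ level inequality; **`hclr₃_YA_gen`**.
builds on p205010 (kernel theorem, internal audit signed; external expert review pending) — nothing in this file uses p205010; NOTHING is claimed about the node
`SamePDropOfSkeletonNeg₁` (OPEN); integer arithmetic only.
Lane `prim-bschramm-*`, seat `prim-bschramm-p1` (gen 14); helper file (`--supports stmt-CriticalPhenomena-4575 --as helper`); slot-ledger ζ′ v1.
[cite: KozmaNitzan2024, §4 Lemma 12 (pp. 23–25)] [cite: MartineauTassion2017, §4.3 Lemma 4.2]
-/

noncomputable section

open scoped Classical

namespace Summit.CriticalPhenomena.PercolationContinuityZ3.Theorems.Transplant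

namespace PlanarSkeletonNeg

namespace NegB

open Literature.Probability.Percolation Literature.Probability.LatticeModels SimpleGraph
open Literature.Probability.Percolation.KozmaNitzan.Cells (oth sgOf sgOf_sign)
open SkelConc (Consts)
open Skelφ (shearUnit shearUnit_pos xBoxLoA xBoxHiA xBoxB crossOffY)
open Skelφ.StepI (DataN)
open TwoAxis.Para (modulus)
open Neg

namespace KS

/-! ## §1 Generic arithmetic (chain-free) -/

section Arith

/-- **The level branch of the y′-face `hclr₃`, pure arithmetic**: with `n ≤ U ≤ 11n`, `ℓ ≥ 22000·Q·(R+2)`, `m ≤ nℓ`, `M + 2 ≤ R`, `N ≥ 13`,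
`0 ≤ k`, `k + 2 ≤ 2000·Q`, and the structural bounds `U·s ≥ nℓ − 2U + 2`, `U·W ≤ nℓ + U`, `U·Lb ≤ 3nℓ + U`, any `T ≥ (N+1)·(U·s) − 9m − n` satisfies
`U·M + U·((W + k·R + R + Lb) + 1) ≤ T`. [folklore] -/
theorem clr_tanX_level_arith {n ℓ U R Q M m N k s W Lb T : ℤ} (hn : 1 ≤ n) (hU1 : n ≤ U) (hU2 : U ≤ 11 * n) (hR : 0 ≤ R) (hQ : 1 ≤ Q)
    (hℓ : 22000 * Q * (R + 2) ≤ ℓ) (hm : m ≤ n * ℓ) (hM : M + 2 ≤ R) (hN : 13 ≤ N) (hk0 : 0 ≤ k) (hk : k + 2 ≤ 2000 * Q)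
    (hs : n * ℓ - 2 * U + 2 ≤ U * s) (hW : U * W ≤ n * ℓ + U) (hLb : U * Lb ≤ 3 * (n * ℓ) + U) (hT : (N + 1) * (U * s) - 9 * m - n ≤ T) :
    U * M + U * ((W + k * R + R + Lb) + 1) ≤ T := by
  have hn0 : 0 ≤ n := by linarith
  have hU0 : 0 ≤ U := by linarith
  have hN0 : 0 ≤ N + 1 := by linarith
  have h1 : (N + 1) * (n * ℓ - 2 * U + 2) ≤ (N + 1) * (U * s) := mul_le_mul_of_nonneg_left hs hN0
  have hNU : (N + 1) * U ≤ (N + 1) * (11 * n) := mul_le_mul_of_nonneg_left hU2 hN0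
  have hUR : U * R ≤ 11 * n * R := mul_le_mul_of_nonneg_right hU2 hR
  have hk1 : 0 ≤ k + 1 := by linarith
  have hURk : (k + 1) * (U * R) ≤ (k + 1) * (11 * n * R) := mul_le_mul_of_nonneg_left hUR hk1
  have hUM : U * M ≤ U * (R - 2) := mul_le_mul_of_nonneg_left (by linarith) hU0
  have hnR0 : 0 ≤ n * R := mul_nonneg hn0 hR
  have hkQ : n * R * (k + 2) ≤ n * R * (2000 * Q) := mul_le_mul_of_nonneg_left hk hnR0
  have hnℓ : n * (22000 * Q * (R + 2)) ≤ n * ℓ := mul_le_mul_of_nonneg_left hℓ hn0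
  have hN12 : 0 ≤ N - 12 := by linarith
  have hnℓN : (N - 12) * (n * (22000 * Q * (R + 2))) ≤ (N - 12) * (n * ℓ) := mul_le_mul_of_nonneg_left hnℓ hN12
  have hQRn0 : 0 ≤ 22000 * Q * R * n := by
    have : 0 ≤ Q := by linarith
    positivity
  have hN12' : 1 * (22000 * Q * R * n) ≤ (N - 12) * (22000 * Q * R * n) := mul_le_mul_of_nonneg_right (by linarith) hQRn0
  have hQn : 1 * n ≤ Q * n := mul_le_mul_of_nonneg_right hQ hn0
  have hQnN : (N - 12) * (1 * n) ≤ (N - 12) * (Q * n) := mul_le_mul_of_nonneg_left hQn hN12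
  have hNn : 13 * n ≤ N * n := mul_le_mul_of_nonneg_right hN hn0
  nlinarith

end Arith

/-! ## §2 The tangential origin's level at the (ζ′) tuple -/

section Origin

variable (κ : Consts) {V : Type} [DecidableEq V] [Countable V] {G : SimpleGraph V} [G.LocallyFinite] (Φ : PlanarSkeletonNeg G) (t : V)
  (p : unitInterval) (D : DataN V) (g f : ℕ)

/-- **The level of the canonical y′ → x offset**: `σ(Nr+1)·sLo·U − n_L < n_L·(crossOffY …) 1 − h_L·(crossOffY …) 0 ≤ σ(Nr+1)·sLo·U` (the along
start of the last y′-core, up to the residual of the division by `n_L`). [folklore] -/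
theorem clr_lvl_crossOffY_bounds (hN : EqNumL κ Φ t p D g f) (σ : ℤ) (Nr : ℕ) :
    σ * (((Nr : ℤ) + 1) * (((nL κ Φ t p D g f : ℤ) * ℓL κ Φ t p D g f - (shearUnit (nL κ Φ t p D g f) (hL κ Φ t p D g f) : ℕ) + 1) /
        (shearUnit (nL κ Φ t p D g f) (hL κ Φ t p D g f) : ℕ))) * (shearUnit (nL κ Φ t p D g f) (hL κ Φ t p D g f) : ℤ) - nL κ Φ t p D g f <
      (nL κ Φ t p D g f : ℤ) * (crossOffY (nL κ Φ t p D g f) (ℓL κ Φ t p D g f) (hL κ Φ t p D g f) (vL κ Φ t p D g f) σ Nr) 1 -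
        hL κ Φ t p D g f * (crossOffY (nL κ Φ t p D g f) (ℓL κ Φ t p D g f) (hL κ Φ t p D g f) (vL κ Φ t p D g f) σ Nr) 0 ∧
    (nL κ Φ t p D g f : ℤ) * (crossOffY (nL κ Φ t p D g f) (ℓL κ Φ t p D g f) (hL κ Φ t p D g f) (vL κ Φ t p D g f) σ Nr) 1 -
        hL κ Φ t p D g f * (crossOffY (nL κ Φ t p D g f) (ℓL κ Φ t p D g f) (hL κ Φ t p D g f) (vL κ Φ t p D g f) σ Nr) 0 ≤
      σ * (((Nr : ℤ) + 1) * (((nL κ Φ t p D g f : ℤ) * ℓL κ Φ t p D g f - (shearUnit (nL κ Φ t p D g f) (hL κ Φ t p D g f) : ℕ) + 1) /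
        (shearUnit (nL κ Φ t p D g f) (hL κ Φ t p D g f) : ℕ))) * (shearUnit (nL κ Φ t p D g f) (hL κ Φ t p D g f) : ℤ) := by
  obtain ⟨hn1, -⟩ := one_le_of_eqNumL κ Φ t p D g f hN
  have hn0 : (0 : ℤ) < (nL κ Φ t p D g f : ℤ) := by exact_mod_cast hn1
  unfold Skelφ.crossOffY
  simp only [Skelφ.pt_zero, Skelφ.pt_one]
  set X : ℤ := σ * (((Nr : ℤ) + 1) * (((nL κ Φ t p D g f : ℤ) * ℓL κ Φ t p D g f - (shearUnit (nL κ Φ t p D g f) (hL κ Φ t p D g f) : ℕ) + 1) /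
      (shearUnit (nL κ Φ t p D g f) (hL κ Φ t p D g f) : ℕ))) * (shearUnit (nL κ Φ t p D g f) (hL κ Φ t p D g f) : ℤ) +
    hL κ Φ t p D g f * (σ * (((Nr : ℤ) + 1) * vL κ Φ t p D g f)) with hX
  obtain ⟨f1, f2⟩ := RootArith.floor_sandwich (x := X) hn0
  constructor
  · nlinarith
  · nlinarith

/-- **The tangential origin of a y′-face is HIGH**: for `yT = yL + crossOffY … σ Nr` with `σ = ±1` and `|F1cA yL| ≤ 8u₁`,
`(Nr+1)·(U·sLo) − 9m − n_L ≤ |n_L·yT 1 − h_L·yT 0|`. [folklore] -/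
theorem clr_abs_lvl_yTY_ge (hN : EqNumL κ Φ t p D g f) (yL : Site 2) (he1 : |F1cA κ Φ t p D g f yL| ≤ 8 * u₁A κ Φ t p D g f)
    {σ : ℤ} (hσ : σ = 1 ∨ σ = -1) (Nr : ℕ) :
    ((Nr : ℤ) + 1) * ((shearUnit (nL κ Φ t p D g f) (hL κ Φ t p D g f) : ℤ) *
          (((nL κ Φ t p D g f : ℤ) * ℓL κ Φ t p D g f - (shearUnit (nL κ Φ t p D g f) (hL κ Φ t p D g f) : ℕ) + 1) /
            (shearUnit (nL κ Φ t p D g f) (hL κ Φ t p D g f) : ℕ))) -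
        9 * modulus (nL κ Φ t p D g f) (hL κ Φ t p D g f) (vL κ Φ t p D g f) (vβL κ Φ t p D g f) - nL κ Φ t p D g f ≤
      |(nL κ Φ t p D g f : ℤ) * (yL + crossOffY (nL κ Φ t p D g f) (ℓL κ Φ t p D g f) (hL κ Φ t p D g f) (vL κ Φ t p D g f) σ Nr) 1 -
        hL κ Φ t p D g f * (yL + crossOffY (nL κ Φ t p D g f) (ℓL κ Φ t p D g f) (hL κ Φ t p D g f) (vL κ Φ t p D g f) σ Nr) 0| := by
  obtain ⟨hn1, -⟩ := one_le_of_eqNumL κ Φ t p D g f hN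
  obtain ⟨c1, c2⟩ := clr_lvl_crossOffY_bounds κ Φ t p D g f hN σ Nr
  have hΛ := abs_le.1 (clr_abs_Λ₁of_le κ Φ t p D g f hN yL (by norm_num : (0:ℤ) ≤ 8) he1)
  have hs := clr_mul_sLo_ge hn1 (hL κ Φ t p D g f) (ℓL κ Φ t p D g f)
  have hU := shearUnit_pos hn1 (hL κ Φ t p D g f)
  -- split the level into the origin's `Λ₁` and the offset's level
  have e : (nL κ Φ t p D g f : ℤ) * (yL + crossOffY (nL κ Φ t p D g f) (ℓL κ Φ t p D g f) (hL κ Φ t p D g f) (vL κ Φ t p D g f) σ Nr) 1 -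
        hL κ Φ t p D g f * (yL + crossOffY (nL κ Φ t p D g f) (ℓL κ Φ t p D g f) (hL κ Φ t p D g f) (vL κ Φ t p D g f) σ Nr) 0 =
      Λ₁of κ Φ t p D g f yL +
        ((nL κ Φ t p D g f : ℤ) * (crossOffY (nL κ Φ t p D g f) (ℓL κ Φ t p D g f) (hL κ Φ t p D g f) (vL κ Φ t p D g f) σ Nr) 1 -
          hL κ Φ t p D g f * (crossOffY (nL κ Φ t p D g f) (ℓL κ Φ t p D g f) (hL κ Φ t p D g f) (vL κ Φ t p D g f) σ Nr) 0) := by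
    unfold Λ₁of; simp only [Pi.add_apply]; ring
  rw [e]
  set S : ℤ := (shearUnit (nL κ Φ t p D g f) (hL κ Φ t p D g f) : ℤ) *
      (((nL κ Φ t p D g f : ℤ) * ℓL κ Φ t p D g f - (shearUnit (nL κ Φ t p D g f) (hL κ Φ t p D g f) : ℕ) + 1) /
        (shearUnit (nL κ Φ t p D g f) (hL κ Φ t p D g f) : ℕ)) with hS
  set Lc := (nL κ Φ t p D g f : ℤ) * (crossOffY (nL κ Φ t p D g f) (ℓL κ Φ t p D g f) (hL κ Φ t p D g f) (vL κ Φ t p D g f) σ Nr) 1 -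
      hL κ Φ t p D g f * (crossOffY (nL κ Φ t p D g f) (ℓL κ Φ t p D g f) (hL κ Φ t p D g f) (vL κ Φ t p D g f) σ Nr) 0
  have eS : σ * (((Nr : ℤ) + 1) * (((nL κ Φ t p D g f : ℤ) * ℓL κ Φ t p D g f - (shearUnit (nL κ Φ t p D g f) (hL κ Φ t p D g f) : ℕ) + 1) /
        (shearUnit (nL κ Φ t p D g f) (hL κ Φ t p D g f) : ℕ))) * (shearUnit (nL κ Φ t p D g f) (hL κ Φ t p D g f) : ℤ) = σ * (((Nr : ℤ) + 1) * S) := by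
    rw [hS]; ring
  rw [eS] at c1 c2
  have hn0 : (0 : ℤ) ≤ (nL κ Φ t p D g f : ℤ) := by positivity
  rcases hσ with h | h
  · rw [h, one_mul] at c1 c2
    calc ((Nr : ℤ) + 1) * S - 9 * modulus (nL κ Φ t p D g f) (hL κ Φ t p D g f) (vL κ Φ t p D g f) (vβL κ Φ t p D g f) - nL κ Φ t p D g f
        ≤ Λ₁of κ Φ t p D g f yL + Lc := by linarith [hΛ.1]
      _ ≤ |Λ₁of κ Φ t p D g f yL + Lc| := le_abs_self _
  · rw [h, neg_one_mul] at c1 c2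
    calc ((Nr : ℤ) + 1) * S - 9 * modulus (nL κ Φ t p D g f) (hL κ Φ t p D g f) (vL κ Φ t p D g f) (vβL κ Φ t p D g f) - nL κ Φ t p D g f
        ≤ -(Λ₁of κ Φ t p D g f yL + Lc) := by linarith [hΛ.2, hn0]
      _ ≤ |Λ₁of κ Φ t p D g f yL + Lc| := neg_le_abs _

end Origin

/-! ## §3 The y′-face field `hclr₃` (generic in the skeleton-to-be's choice functions) -/

section Fields

variable (κ : Consts) {V : Type} [DecidableEq V] [Countable V] {G : SimpleGraph V} [G.LocallyFinite] (Φ : PlanarSkeletonNeg G) (t : V)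
  (p : unitInterval) (D : DataN V) (mk g f : ℕ)

/-- **M3 y′-face field `hclrLo` at the (ζ′) tuple, generic form** (`FloorsY2.hclrLo` with `pr.vα = v_L`, `R's := RA′ mk`, `Mz := M_u`): on the hop
side `σ·σh = 1` the along y′-run's transverse floors clear the seed box, from the ONE v-free origin floor `M_u + 2n_L + v_L + (Nr+1)·RA′ < σ·yL 0`
with `0 ≤ v_L` (= `Skelφ.hclrP_of_clearF` at `c_lo := σ·yL 0 − n_L − v_L`; for the origins of record `σ·yLF? 0 = σσh·(c_lo + n_L) + v_L`
(`yLFs/d/t_zero`) the floor is `KS.clearF_s/d/t` with `Nr + 1 ≤ c`). [cite: KozmaNitzan2024, §4 Lemma 11 (p. 22)] -/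
theorem hclrLo_YA_gen (hN : EqNumL κ Φ t p D g f) (du : MDir) {σh : ℤ} (yL : Site 2) {Nr : ℕ}
    (hlo : sgOf du * σh = 1 → 0 ≤ vL κ Φ t p D g f ∧
      ((Mu D : ℕ) : ℤ) + 2 * (nL κ Φ t p D g f : ℤ) + vL κ Φ t p D g f + ((Nr : ℤ) + 1) * (RA' κ Φ t p D mk : ℤ) < sgOf du * yL 0) :
    sgOf du * σh = 1 → ∀ k ≤ Nr, ((Mu D : ℕ) : ℤ) < Skelφ.yBoxLoT (nL κ Φ t p D g f) (vL κ Φ t p D g f) (RA' κ Φ t p D mk) k + sgOf du * yL 0 := by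
  intro h k hk
  obtain ⟨hv0, hF⟩ := hlo h
  exact Skelφ.hclrP_of_clearF hN.v_le hv0 (RA' κ Φ t p D mk) Nr (clo := sgOf du * yL 0 - nL κ Φ t p D g f - vL κ Φ t p D g f)
    (a := sgOf du * yL 0) (M := ((Mu D : ℕ) : ℤ)) (by ring) (by linarith) k hk

/-- **M3 y′-face field `hclrHi` at the (ζ′) tuple, generic form**: on the opposite hop side `σ·σh = −1` the along y′-run's transverse ceilings stay
below `−M_u`, from `σ·yL 0 + M_u + 2n_L − v_L + (Nr+1)·RA′ < 0` with `v_L ≤ 0` (= `Skelφ.hclrM_of_clearF` at `c_lo := −σ·yL 0 − n_L + v_L`).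
[cite: KozmaNitzan2024, §4 Lemma 11 (p. 22)] -/
theorem hclrHi_YA_gen (hN : EqNumL κ Φ t p D g f) (du : MDir) {σh : ℤ} (yL : Site 2) {Nr : ℕ}
    (hhi : sgOf du * σh = -1 → vL κ Φ t p D g f ≤ 0 ∧
      sgOf du * yL 0 + ((Mu D : ℕ) : ℤ) + 2 * (nL κ Φ t p D g f : ℤ) - vL κ Φ t p D g f + ((Nr : ℤ) + 1) * (RA' κ Φ t p D mk : ℤ) < 0) :
    sgOf du * σh = -1 → ∀ k ≤ Nr, Skelφ.yBoxHiT (nL κ Φ t p D g f) (vL κ Φ t p D g f) (RA' κ Φ t p D mk) k + sgOf du * yL 0 < -((Mu D : ℕ) : ℤ) := by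
  intro h k hk
  obtain ⟨hv0, hF⟩ := hhi h
  exact Skelφ.hclrM_of_clearF hN.v_le hv0 (RA' κ Φ t p D mk) Nr (clo := -(sgOf du * yL 0) - nL κ Φ t p D g f + vL κ Φ t p D g f)
    (a := sgOf du * yL 0) (M := ((Mu D : ℕ) : ℤ)) (by ring) (by linarith) k hk

/-- **M3 y′-face field `hclr₃` at the (ζ′) tuple, generic form** (`FloorsY2.hclr₃` with `pr := prFA` (`.h = h_L`, `.vα = v_L`), `ℓ' := ℓ_L`, `Mz := M_u`,
`R'₃ := RA′ mk`; the landing origin `yL`, the along count `Nr`, the tangential count `N₃`, sign `σT` and start half-width `qB₃` free): every region of the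
tangential x-run clears the seed box BY LEVEL. [cite: KozmaNitzan2024, §4 Lemma 12 (pp. 23–25)] [cite: MartineauTassion2017, §4.3 Lemma 4.2] -/
theorem hclr₃_YA_gen (hN : EqNumL κ Φ t p D g f) (hκ : (hL κ Φ t p D g f).natAbs ≤ 10 * nL κ Φ t p D g f)
    (hℓA : 22000 * Neg.Kq κ * (RA' κ Φ t p D mk + 2) ≤ ℓL κ Φ t p D g f) (du : MDir)
    (yL : Site 2) (he1 : |F1cA κ Φ t p D g f yL| ≤ 8 * u₁A κ Φ t p D g f) {Nr N₃ : ℕ} (hNr : 13 ≤ Nr) (hN₃ : N₃ + 2 ≤ 2000 * Neg.Kq κ)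
    (σT : ℤ) (qB₃ : ℕ) :
    ∀ k ≤ N₃, (∀ b : ℤ, min (σT * xBoxLoA (nL κ Φ t p D g f) qB₃ (RA' κ Φ t p D mk) k) (σT * xBoxHiA (nL κ Φ t p D g f) qB₃ (RA' κ Φ t p D mk) k) ≤ b →
        b ≤ max (σT * xBoxLoA (nL κ Φ t p D g f) qB₃ (RA' κ Φ t p D mk) k) (σT * xBoxHiA (nL κ Φ t p D g f) qB₃ (RA' κ Φ t p D mk) k) →
        ((Mu D : ℕ) : ℤ) < |b + (yL + crossOffY (nL κ Φ t p D g f) (ℓL κ Φ t p D g f) (hL κ Φ t p D g f) (vL κ Φ t p D g f) (sgOf du) Nr) 0|) ∨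
      ((shearUnit (nL κ Φ t p D g f) (hL κ Φ t p D g f) : ℤ) * (Mu D) +
          (shearUnit (nL κ Φ t p D g f) (hL κ Φ t p D g f) : ℤ) * (xBoxB (nL κ Φ t p D g f) (ℓL κ Φ t p D g f) (hL κ Φ t p D g f) (RA' κ Φ t p D mk) k + 1) ≤
        |(nL κ Φ t p D g f : ℤ) * (yL + crossOffY (nL κ Φ t p D g f) (ℓL κ Φ t p D g f) (hL κ Φ t p D g f) (vL κ Φ t p D g f) (sgOf du) Nr) 1 -
          hL κ Φ t p D g f * (yL + crossOffY (nL κ Φ t p D g f) (ℓL κ Φ t p D g f) (hL κ Φ t p D g f) (vL κ Φ t p D g f) (sgOf du) Nr) 0|) := by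
  intro k hk
  right
  obtain ⟨hn1, hℓ1⟩ := one_le_of_eqNumL κ Φ t p D g f hN
  have hn0 : (1 : ℤ) ≤ (nL κ Φ t p D g f : ℤ) := by exact_mod_cast hn1
  have hσ : sgOf du = 1 ∨ sgOf du = -1 := sgOf_sign du
  have hq1 : (1 : ℤ) ≤ (Neg.Kq κ : ℤ) := by exact_mod_cast Neg.one_le_Kq κ
  have hR0 : (0 : ℤ) ≤ (RA' κ Φ t p D mk : ℤ) := Nat.cast_nonneg _
  have hℓA' : 22000 * (Neg.Kq κ : ℤ) * ((RA' κ Φ t p D mk : ℤ) + 2) ≤ (ℓL κ Φ t p D g f : ℤ) := by exact_mod_cast hℓA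
  have hMz : ((Mu D : ℕ) : ℤ) + 2 ≤ (RA' κ Φ t p D mk : ℤ) := by exact_mod_cast Mu_add_two_le_RA' κ Φ t p D mk
  obtain ⟨hU1, hU2⟩ := clr_shearUnit_bounds κ Φ t p D g f hκ
  obtain ⟨-, hm2⟩ := Skelφ.NegPrm.modulus_vβOf hn1 (hL κ Φ t p D g f) (ℓL κ Φ t p D g f) (vL κ Φ t p D g f)
  have e : Skelφ.NegPrm.vβOf (nL κ Φ t p D g f) (hL κ Φ t p D g f) (ℓL κ Φ t p D g f) (vL κ Φ t p D g f) = vβL κ Φ t p D g f := rfl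
  rw [e] at hm2
  have hT := clr_abs_lvl_yTY_ge κ Φ t p D g f hN yL he1 hσ Nr
  have hs := clr_mul_sLo_ge hn1 (hL κ Φ t p D g f) (ℓL κ Φ t p D g f)
  obtain ⟨hW, hLb⟩ := Wrun_spec κ Φ t p D g f hn1
  unfold Wrun at hW
  unfold Lbrun at hLb
  have hNr' : (13 : ℤ) ≤ (Nr : ℤ) := by exact_mod_cast hNr
  have hk0 : (0 : ℤ) ≤ (k : ℤ) := Nat.cast_nonneg _
  have hk' : (k : ℤ) + 2 ≤ 2000 * (Neg.Kq κ : ℤ) := by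
    have : ((k + 2 : ℕ) : ℤ) ≤ ((2000 * Neg.Kq κ : ℕ) : ℤ) := by exact_mod_cast (le_trans (by omega) hN₃)
    push_cast at this; exact this
  unfold Skelφ.xBoxB
  exact clr_tanX_level_arith hn0 hU1 hU2 hR0 hq1 hℓA' hm2 hMz hNr' hk0 hk' hs hW hLb hT

end Fields

end KS

end NegB

end PlanarSkeletonNeg

end Summit.CriticalPhenomena.PercolationContinuityZ3.Theorems.Transplant

end
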